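import Literature.NumberTheory.NumberFields.RayClassFieldAdicTowerAbsolute
import Literature.NumberTheory.NumberFields.RayClassFieldArtinSymbolSurjective
import Literature.NumberTheory.LFunctions.RayClassPartialZeta
import HarnessLib

/-!
# The level-`0` cells of the `v`-ray class tower in `Γ_K` ARE the ray classes: Artin-symbol labels, `RayClassRel`, and the
# reindexing of cell sums as sums over a system of ray class representatives (de Shalit II.4.7 (16): "`𝔠` running over integral
# ideals representing `Gal(F/K)`")

Topic `NumberTheory/NumberFields`; namespace `Literature.NumberTheory.NumberFields`.

De Shalit, *Iwasawa theory of elliptic curves with complex multiplication* (1987), II.4.7 (16) (p. 60) and II.4.10–4.11 (p. 64–65):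
the coset sum over `𝒢/G = Gal(K(𝔣)/K)` is written as a sum over integral ideals `𝔠` representing the ray classes mod `𝔣`, and
the partial `L`-series of II.3.5 (13) / the class sums of II.4.11 are indexed by the same representatives.  On the Galois side the
tree has the tower `absRayAdicTower h𝔣 v` of `Γ_K` (`U_0 = Gal(K̄/K(𝔣v))`, `RayClassFieldAdicTowerAbsolute.lean`) whose level-`0`
cells index the two-variable integral formulas of `Summits/…/PrintCf2RubinValueTwoEllipticUnitsTwoVariable*`; on the complex side
the class sums of `EisensteinClassSumInterpolation.lean` run over a `Finset` `T` with `IsRayClassReps 𝔪 T`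
(`LFunctions/RayClassPartialZeta.lean`).  THIS file is the dictionary (`K` totally complex, `𝔪₀ = 𝔣·v`):

* §1 `artinSymbol_eq_galEquiv_symm_integralRayClass`, ★ `artinSymbol_eq_artinSymbol_iff_rayClassRel` — two non-zero integral ideals
  prime to `𝔪` have the same Artin symbol in `Gal(K(𝔪)/K)` iff they lie in the same ray class mod `𝔪` (Neukirch VI (7.1) with (1.9));
* §2 `absRayAdicTower_proj_zero_eq_iff` (cells at level `0` = restrictions to `K(𝔣v)`), ★ `absRayAdicTower_proj_zero_eq_iff_rayClassRel`
  (two elements of `Γ_K` acting on `K(𝔣v)` as the Artin symbols of `𝔞`, `𝔟` lie in the same level-`0` cell iff `𝔞 ∼ 𝔟 mod 𝔣v`),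
  `exists_ideal_forall_proj_zero_eq` (every cell is labelled by an integral ideal prime to `𝔣v`);
* §3 ★★ `isRayClassReps_image_of_artin_labels` — if `a : Γ_K/U_0 → ideals` labels the cells through elements `t_c ∈ Γ_K` acting on
  `K(𝔣v)` as the Artin symbols of `a c`, with `c ↦ t_c U_0` bijective (e.g. `t_c = g_{a c}` Artin lifts with `g_{a c} U_0 = c⁻¹`), then the
  labels form a system of representatives of the ray classes mod `𝔣v` (`IsRayClassReps`), `a` is injective (`eq_of_artin_labels_eq`), and ★
  `sum_cells_zero_eq_sum_image` — `Σ_{c ∈ Γ_K/U_0} F(a c) = Σ_{𝔟 ∈ image a} F(𝔟)`.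

Everything is a theorem; no named facts, no instances, no `sorry`.

## References

* [NeukirchANT1999] J. Neukirch, *Algebraic Number Theory* (1999), Ch. VI §7 Thm. (7.1), Ch. VI §1 (1.7)–(1.9), Exercise 11.
* [deShalit1987] E. de Shalit, *Iwasawa theory of elliptic curves with complex multiplication* (1987), II.4.7 (16) (p. 60),
  II.4.11 (p. 65), II.4.1 (p. 56).
-/

noncomputable section

open NumberField IsDedekindDomain IsDedekindDomain.HeightOneSpectrum Field
open scoped nonZeroDivisors Classical

namespace Literature.NumberTheory.NumberFields

open Literature.NumberTheory.GaloisRepresentations Literature.NumberTheory.LFunctions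
open Literature.NumberTheory.LFunctions.AbelianDensity (artinSymbol)
open Literature.NumberTheory.EllipticCurves (SubgroupTower)

variable {K : Type} [Field K] [NumberField K]

/-- Restriction `Γ_K → Gal(E/K)` is onto for a normal `E ⊆ K̄` (Mathlib `AlgEquiv.restrictNormalHom_surjective`; private plumbing).
[folklore] -/
private theorem absRestrictNormalHom_surjective (E : IntermediateField K (AlgebraicClosure K)) [Normal K E] :
    Function.Surjective (absRestrictNormalHom E) := fun g ↦ by
  obtain ⟨σ, hσ⟩ := AlgEquiv.restrictNormalHom_surjective (AlgebraicClosure K) g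
  exact ⟨(Field.absoluteGaloisGroup.toAlgEquiv K).symm σ, hσ⟩

variable [IsTotallyComplex K]

/-! ### §1. Artin symbols of integral ideals and ray classes -/

section Classes

variable {𝔪 : Ideal (𝓞 K)} (h𝔪 : 𝔪 ≠ ⊥)

include h𝔪 in
/-- **The Artin symbol of an integral ideal `𝔞` prime to `𝔪` is the image of its ray class** under the inverse of
`G(K(𝔪)|K) ≅ Cl_K^𝔪`. [cite: NeukirchANT1999, Ch. VI §7 Thm. (7.1)] -/
theorem artinSymbol_eq_galEquiv_symm_integralRayClass {𝔞 : Ideal (𝓞 K)} (h0 : 𝔞 ≠ ⊥) (hc : IsCoprime 𝔞 𝔪) :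
    artinSymbol (galFrob K (rayClassField K 𝔪)) 𝔞 =
      (rayClassField_galEquivRayClassGroup h𝔪).symm (integralRayClass 𝔪 h𝔪 ⟨𝔞, h0, hc⟩) := by
  rw [← artinHom_unitsMk0_coeIdeal _ h0,
    ← rayClassField_galEquivRayClassGroup_symm_mk_eq_artinHom h𝔪 (unitsMk0_coeIdeal_mem_idealsPrimeTo h𝔪 h0 hc)]
  rfl

include h𝔪 in
/-- ★ **Equal Artin symbols ⟺ same ray class**: for non-zero integral ideals `𝔞`, `𝔟` prime to `𝔪`,
`(𝔞, K(𝔪)/K) = (𝔟, K(𝔪)/K) ⟺ 𝔞 ∼ 𝔟 mod 𝔪` (`RayClassRel`; Artin reciprocity: the kernel of the Artin symbol on `J^𝔪` is `P^𝔪`).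
[cite: NeukirchANT1999, Ch. VI §7 Thm. (7.1), Ch. VI §1 Prop. (1.9)] -/
theorem artinSymbol_eq_artinSymbol_iff_rayClassRel {𝔞 𝔟 : Ideal (𝓞 K)} (h𝔞0 : 𝔞 ≠ ⊥) (h𝔞c : IsCoprime 𝔞 𝔪)
    (h𝔟0 : 𝔟 ≠ ⊥) (h𝔟c : IsCoprime 𝔟 𝔪) :
    artinSymbol (galFrob K (rayClassField K 𝔪)) 𝔞 = artinSymbol (galFrob K (rayClassField K 𝔪)) 𝔟 ↔ RayClassRel 𝔪 𝔞 𝔟 := by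
  rw [artinSymbol_eq_galEquiv_symm_integralRayClass h𝔪 h𝔞0 h𝔞c, artinSymbol_eq_galEquiv_symm_integralRayClass h𝔪 h𝔟0 h𝔟c,
    (MulEquiv.injective _).eq_iff]
  exact integralRayClass_eq_iff h𝔪 ⟨𝔟, h𝔟0, h𝔟c⟩ ⟨𝔞, h𝔞0, h𝔞c⟩

end Classes

/-! ### §2. The level-`0` cells of `absRayAdicTower h𝔣 v` and ray classes mod `𝔣v` -/

section Cells

variable {𝔣 : Ideal (𝓞 K)} (h𝔣 : 𝔣 ≠ ⊥) (v : HeightOneSpectrum (𝓞 K))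

omit [IsTotallyComplex K] in
/-- **Cells at level `0` = restrictions to `K(𝔣v)`**: `σ U_0 = τ U_0 ⟺ σ|_{K(𝔣v)} = τ|_{K(𝔣v)}`. [cite: deShalit1987, II.4.1 (p. 56)] -/
theorem absRayAdicTower_proj_zero_eq_iff {σ τ : absoluteGaloisGroup K} :
    (absRayAdicTower h𝔣 v).proj 0 σ = (absRayAdicTower h𝔣 v).proj 0 τ ↔
      absRestrictNormalHom (rayClassField K (𝔣 * v.asIdeal ^ ((0 : ℕ) + 1))) σ =
        absRestrictNormalHom (rayClassField K (𝔣 * v.asIdeal ^ ((0 : ℕ) + 1))) τ := by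
  rw [SubgroupTower.proj_eq_iff, mem_absRayAdicTower_U_iff, MonoidHom.mem_ker, map_mul, map_inv, inv_mul_eq_one, eq_comm]

/-- ★ **Same cell ⟺ same ray class**: if `σ`, `τ ∈ Γ_K` act on `K(𝔣v)` as the Artin symbols of the non-zero integral ideals `𝔞`, `𝔟`
prime to `𝔣v`, then `σ U_0 = τ U_0 ⟺ 𝔞 ∼ 𝔟 mod 𝔣v`. [cite: NeukirchANT1999, Ch. VI §7 Thm. (7.1)] [cite: deShalit1987, II.4.7 (16) (p. 60)] -/
theorem absRayAdicTower_proj_zero_eq_iff_rayClassRel {σ τ : absoluteGaloisGroup K} {𝔞 𝔟 : Ideal (𝓞 K)} (h𝔞0 : 𝔞 ≠ ⊥)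
    (h𝔞c : IsCoprime 𝔞 (𝔣 * v.asIdeal ^ ((0 : ℕ) + 1))) (h𝔟0 : 𝔟 ≠ ⊥) (h𝔟c : IsCoprime 𝔟 (𝔣 * v.asIdeal ^ ((0 : ℕ) + 1)))
    (hσ : absRestrictNormalHom (rayClassField K (𝔣 * v.asIdeal ^ ((0 : ℕ) + 1))) σ =
      artinSymbol (galFrob K (rayClassField K (𝔣 * v.asIdeal ^ ((0 : ℕ) + 1)))) 𝔞)
    (hτ : absRestrictNormalHom (rayClassField K (𝔣 * v.asIdeal ^ ((0 : ℕ) + 1))) τ =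
      artinSymbol (galFrob K (rayClassField K (𝔣 * v.asIdeal ^ ((0 : ℕ) + 1)))) 𝔟) :
    (absRayAdicTower h𝔣 v).proj 0 σ = (absRayAdicTower h𝔣 v).proj 0 τ ↔ RayClassRel (𝔣 * v.asIdeal ^ ((0 : ℕ) + 1)) 𝔞 𝔟 := by
  rw [absRayAdicTower_proj_zero_eq_iff, hσ, hτ,
    artinSymbol_eq_artinSymbol_iff_rayClassRel (mul_ne_zero h𝔣 (pow_ne_zero _ v.ne_bot)) h𝔞0 h𝔞c h𝔟0 h𝔟c]

/-- **Every level-`0` cell is labelled by an integral ideal prime to `𝔣v`**: for every `c ∈ Γ_K/U_0` there is a non-zero integral `𝔞`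
prime to `𝔣v` such that every `τ ∈ Γ_K` acting on `K(𝔣v)` as the Artin symbol of `𝔞` lies in `c`.
[cite: NeukirchANT1999, Ch. VI §7 Thm. (7.1), Ch. VI §1 Exercise 11] [cite: deShalit1987, II.4.7 (16) (p. 60)] -/
theorem exists_ideal_forall_proj_zero_eq (c : absoluteGaloisGroup K ⧸ (absRayAdicTower h𝔣 v).U 0) :
    ∃ 𝔞 : Ideal (𝓞 K), 𝔞 ≠ ⊥ ∧ IsCoprime 𝔞 (𝔣 * v.asIdeal ^ ((0 : ℕ) + 1)) ∧
      ∀ τ : absoluteGaloisGroup K, absRestrictNormalHom (rayClassField K (𝔣 * v.asIdeal ^ ((0 : ℕ) + 1))) τ =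
        artinSymbol (galFrob K (rayClassField K (𝔣 * v.asIdeal ^ ((0 : ℕ) + 1)))) 𝔞 → (absRayAdicTower h𝔣 v).proj 0 τ = c := by
  obtain ⟨𝔞, h0, hc, h⟩ := exists_ideal_artinSymbol_eq_absRestrictNormalHom (mul_ne_zero h𝔣 (pow_ne_zero _ v.ne_bot))
    ((absRayAdicTower h𝔣 v).repr 0 c)
  refine ⟨𝔞, h0, hc, fun τ hτ ↦ ?_⟩
  rw [← (absRayAdicTower h𝔣 v).proj_repr 0 c, absRayAdicTower_proj_zero_eq_iff, hτ, h]

end Cells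

/-! ### §3. Labels through a section: a system of representatives, and the reindexing of cell sums -/

section Labels

variable {𝔣 : Ideal (𝓞 K)} (h𝔣 : 𝔣 ≠ ⊥) (v : HeightOneSpectrum (𝓞 K))
  (a : absoluteGaloisGroup K ⧸ (absRayAdicTower h𝔣 v).U 0 → Ideal (𝓞 K)) (ha0 : ∀ c, a c ≠ ⊥)
  (hac : ∀ c, IsCoprime (a c) (𝔣 * v.asIdeal ^ ((0 : ℕ) + 1)))
  (t : absoluteGaloisGroup K ⧸ (absRayAdicTower h𝔣 v).U 0 → absoluteGaloisGroup K)
  (ht : ∀ c, absRestrictNormalHom (rayClassField K (𝔣 * v.asIdeal ^ ((0 : ℕ) + 1))) (t c) =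
    artinSymbol (galFrob K (rayClassField K (𝔣 * v.asIdeal ^ ((0 : ℕ) + 1)))) (a c))
  (hbij : Function.Bijective fun c ↦ (absRayAdicTower h𝔣 v).proj 0 (t c))

include ha0 hac ht hbij in
/-- **The labels are injective**: `a c = a c′ ⟹ c = c′` (equal Artin symbols, equal cells, `c ↦ t_c U_0` injective).
[cite: NeukirchANT1999, Ch. VI §7 Thm. (7.1)] -/
theorem eq_of_artin_labels_eq {c c' : absoluteGaloisGroup K ⧸ (absRayAdicTower h𝔣 v).U 0} (h : a c = a c') : c = c' := by
  apply hbij.1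
  change (absRayAdicTower h𝔣 v).proj 0 (t c) = (absRayAdicTower h𝔣 v).proj 0 (t c')
  rw [absRayAdicTower_proj_zero_eq_iff_rayClassRel h𝔣 v (ha0 c) (hac c) (ha0 c') (hac c') (ht c) (ht c'), h]
  exact RayClassRel.refl _ _

include ha0 hac ht hbij in
/-- ★★ **The labels of the cells form a system of representatives of the ray classes mod `𝔣v`** (`IsRayClassReps`): every non-zero
integral ideal prime to `𝔣v` has the Artin symbol of some `t_c` (restriction `Γ_K → Gal(K(𝔣v)/K)` is onto and `c ↦ t_c U_0` is onto), and
two labels in the same class label the same cell. [cite: NeukirchANT1999, Ch. VI §7 Thm. (7.1), Ch. VI §1 (1.8)] [cite: deShalit1987, II.4.7 (16) (p. 60)] -/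
theorem isRayClassReps_image_of_artin_labels :
    IsRayClassReps (𝔣 * v.asIdeal ^ ((0 : ℕ) + 1)) (((absRayAdicTower h𝔣 v).cells 0).image a) := by
  refine ⟨fun 𝔟 h𝔟 ↦ ?_, fun 𝔟 h𝔟0 h𝔟c ↦ ?_, fun 𝔟 h𝔟 𝔟' h𝔟' hrel ↦ ?_⟩
  · obtain ⟨c, -, rfl⟩ := Finset.mem_image.mp h𝔟
    exact ⟨ha0 c, hac c⟩
  · -- a lift `τ` of `(𝔟, K(𝔣v)/K)` and the cell `c` with `t_c U_0 = τ U_0`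
    obtain ⟨τ, hτ⟩ := absRestrictNormalHom_surjective (rayClassField K (𝔣 * v.asIdeal ^ ((0 : ℕ) + 1)))
      (artinSymbol (galFrob K (rayClassField K (𝔣 * v.asIdeal ^ ((0 : ℕ) + 1)))) 𝔟)
    obtain ⟨c, hc⟩ := hbij.2 ((absRayAdicTower h𝔣 v).proj 0 τ)
    refine ⟨a c, Finset.mem_image_of_mem a ((absRayAdicTower h𝔣 v).mem_cells 0 c), ?_⟩
    exact (absRayAdicTower_proj_zero_eq_iff_rayClassRel h𝔣 v (ha0 c) (hac c) h𝔟0 h𝔟c (ht c) hτ).mp hc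
  · obtain ⟨c, -, rfl⟩ := Finset.mem_image.mp h𝔟
    obtain ⟨c', -, rfl⟩ := Finset.mem_image.mp h𝔟'
    have h : (absRayAdicTower h𝔣 v).proj 0 (t c) = (absRayAdicTower h𝔣 v).proj 0 (t c') :=
      (absRayAdicTower_proj_zero_eq_iff_rayClassRel h𝔣 v (ha0 c) (hac c) (ha0 c') (hac c') (ht c) (ht c')).mpr hrel
    rw [hbij.1 h]

include ha0 hac ht hbij in
/-- ★ **Reindexing the cell sum as a sum over the representatives**: `Σ_{c ∈ Γ_K/U_0} F(a c) = Σ_{𝔟 ∈ image a} F(𝔟)` (the labels are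
injective). [cite: deShalit1987, II.4.7 (16) (p. 60), II.4.11 (p. 65)] -/
theorem sum_cells_zero_eq_sum_image {M : Type*} [AddCommMonoid M] (F : Ideal (𝓞 K) → M) :
    ∑ c ∈ (absRayAdicTower h𝔣 v).cells 0, F (a c) = ∑ 𝔟 ∈ ((absRayAdicTower h𝔣 v).cells 0).image a, F 𝔟 := by
  rw [Finset.sum_image fun c _ c' _ h ↦ eq_of_artin_labels_eq h𝔣 v a ha0 hac t ht hbij h]

end Labels

end Literature.NumberTheory.NumberFields

end
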